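import Literature.LinearAlgebra.Matrix.NearestPositiveSemidefinite
import Literature.Computation.Certificates.SemidefiniteComplementarity
import HarnessLib

/-!
# Self-duality of the positive semidefinite cone (Moutard–Fejér)

For square matrices over `𝕜 = ℝ` or `ℂ` (`RCLike 𝕜`, order `ComplexOrder` on `𝕜`), with the trace
form `⟪A, B⟫ = Tr(A B)`:

* `trace_mul_vecMulVec` / `trace_vecMulVec_mul` : `Tr(A · x yᵀ) = y ⬝ᵥ (A x)` — the rank-one tests;
* `posSemidef_iff_forall_trace_mul_nonneg` (**Moutard–Fejér**, Horn–Johnson Thm 7.5.4; in the words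
  of Boyd–Vandenberghe Example 2.24, "the positive semidefinite cone is self-dual"): a Hermitian `A`
  is positive semidefinite iff `0 ≤ Tr(A B)` for every positive semidefinite `B`; the rank-one tests
  `B = x x*` already suffice (`posSemidef_iff_forall_trace_mul_vecMulVec_nonneg`), a non-PSD
  Hermitian matrix is separated by one of them (`exists_vecMulVec_of_not_posSemidef`), and the set
  form `{A ⪰ 0} = {A Hermitian | ∀ B ⪰ 0, 0 ≤ Tr(A B)}` is `setOf_posSemidef_eq_dual`;
* `trace_mul_pos_of_posDef` : `A ⪰ 0`, `A ≠ 0`, `B ≻ 0 ⇒ 0 < Tr(A B)` (positive definite matrices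
  are interior to the dual cone);
* real corollaries WITHOUT the symmetry hypothesis: `Tr(A B) ≥ 0` for all `B ⪰ 0` iff the symmetric
  part `A + Aᵀ` is positive semidefinite (`forall_trace_mul_nonneg_iff_posSemidef_add_transpose`),
  and the skew example `!![0, 1; -1, 0]` showing why self-duality is stated on the symmetric
  matrices `𝐒ⁿ` (`skew_example_trace_mul_eq_zero`, `skew_example_not_posSemidef`).

REUSED, not restated (tree): the easy half `A, B ⪰ 0 ⇒ 0 ≤ Tr(A B)` is
`Literature.LinearAlgebra.Matrix.NearestPositiveSemidefinite.trace_mul_nonneg`, and the equality case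
`Tr(A B) = 0 ↔ A B = 0 ↔ B A = 0` (Horn–Johnson 7.6.P15; SDP complementary slackness) is
`Literature.Computation.Certificates.SemidefiniteComplementarity.trace_mul_eq_zero_iff` /
`mul_eq_zero_comm` / `trace_mul_eq_zero_iff'` — both imported here. Mathlib supplies
`Matrix.posSemidef_iff_dotProduct_mulVec`, `Matrix.posSemidef_vecMulVec_self_star`,
`Matrix.mul_vecMulVec`, `Matrix.trace_vecMulVec`; it has no form of the converse
(`lean search 'of_forall_trace|forall_posSemidef'`).

Sources: R. A. Horn, C. R. Johnson, *Matrix Analysis*, 2nd ed., CUP 2012 [HornJohnson2012],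
Theorem 7.5.4 (p. 485, held chunk p0587); S. Boyd, L. Vandenberghe, *Convex Optimization*, CUP 2004
[BoydVandenberghe2004], Example 2.24 (p. 52, held chunk p0048).
-/

open Matrix
open scoped ComplexOrder MatrixOrder

namespace Literature.LinearAlgebra.Matrix.PsdConeSelfDual

variable {𝕜 : Type*} [RCLike 𝕜] {n : Type*} [Fintype n]

/-- `Tr(A · vecMulVec x y) = y ⬝ᵥ (A *ᵥ x)`: the trace against a rank-one matrix is a bilinear
form value (the computation `tr(A x̄xᵀ) = x*Ax` in the proof of Moutard–Fejér). [cite: HornJohnson2012, Thm 7.5.4 p.485, proof (held chunk p0587)] -/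
theorem trace_mul_vecMulVec {R : Type*} [CommSemiring R] (A : Matrix n n R) (x y : n → R) :
    (A * vecMulVec x y).trace = y ⬝ᵥ (A *ᵥ x) := by
  rw [Matrix.mul_vecMulVec, trace_vecMulVec, dotProduct_comm]

/-- `Tr(vecMulVec x y · A) = x ⬝ᵥ ... `: companion of `trace_mul_vecMulVec` with the rank-one
matrix on the left: `Tr(x yᵀ A) = x ⬝ᵥ (y ᵥ* A)`. [cite: HornJohnson2012, Thm 7.5.4 p.485, proof (held chunk p0587)] -/
theorem trace_vecMulVec_mul {R : Type*} [CommSemiring R] (A : Matrix n n R) (x y : n → R) :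
    (vecMulVec x y * A).trace = x ⬝ᵥ (y ᵥ* A) := by
  rw [Matrix.vecMulVec_mul, trace_vecMulVec]

/-- The rank-one tests suffice: a Hermitian `A` with `0 ≤ Tr(A · x x*)` for every vector `x` is
positive semidefinite (`Tr(A x x*) = x* A x`). [cite: HornJohnson2012, Thm 7.5.4 p.485, proof (held chunk p0587)] -/
theorem posSemidef_of_forall_trace_mul_vecMulVec_nonneg {A : Matrix n n 𝕜} (hA : A.IsHermitian)
    (h : ∀ x : n → 𝕜, 0 ≤ (A * vecMulVec x (star x)).trace) : A.PosSemidef := by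
  rw [posSemidef_iff_dotProduct_mulVec]
  refine ⟨hA, fun x => ?_⟩
  simpa [trace_mul_vecMulVec] using h x

/-- Hard half of Moutard–Fejér: a Hermitian `A` with `0 ≤ Tr(A B)` for every positive
semidefinite `B` is positive semidefinite. [cite: HornJohnson2012, Thm 7.5.4 p.485 (held chunk p0587)] -/
theorem posSemidef_of_forall_trace_mul_nonneg {A : Matrix n n 𝕜} (hA : A.IsHermitian)
    (h : ∀ B : Matrix n n 𝕜, B.PosSemidef → 0 ≤ (A * B).trace) : A.PosSemidef :=
  posSemidef_of_forall_trace_mul_vecMulVec_nonneg hA fun x => h _ (posSemidef_vecMulVec_self_star x)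

/-- A matrix that is NOT positive semidefinite is separated from the cone by a rank-one positive
semidefinite matrix: `∃ x, ¬ 0 ≤ Tr(A · x x*)` (for Hermitian `A`; over `ℝ` this reads
`Tr(A x xᵀ) < 0`). [cite: BoydVandenberghe2004, Example 2.24 p.52 (held chunk p0048)] -/
theorem exists_vecMulVec_of_not_posSemidef {A : Matrix n n 𝕜} (hA : A.IsHermitian)
    (h : ¬ A.PosSemidef) : ∃ x : n → 𝕜, ¬ 0 ≤ (A * vecMulVec x (star x)).trace := by
  by_contra! hx
  exact h (posSemidef_of_forall_trace_mul_vecMulVec_nonneg hA hx)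

variable [DecidableEq n]

/-- **Moutard–Fejér, rank-one form.** A Hermitian matrix is positive semidefinite iff
`0 ≤ Tr(A · x x*)` for every `x`. [cite: HornJohnson2012, Thm 7.5.4 p.485 (held chunk p0587)] -/
theorem posSemidef_iff_forall_trace_mul_vecMulVec_nonneg {A : Matrix n n 𝕜} (hA : A.IsHermitian) :
    A.PosSemidef ↔ ∀ x : n → 𝕜, 0 ≤ (A * vecMulVec x (star x)).trace :=
  ⟨fun h x => NearestPositiveSemidefinite.trace_mul_nonneg h (posSemidef_vecMulVec_self_star x),
   posSemidef_of_forall_trace_mul_vecMulVec_nonneg hA⟩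

/-- **Moutard–Fejér / self-duality of the PSD cone.** A Hermitian matrix `A` is positive
semidefinite iff `0 ≤ Tr(A B)` for every positive semidefinite `B`.
[cite: HornJohnson2012, Thm 7.5.4 p.485 (held chunk p0587)] -/
theorem posSemidef_iff_forall_trace_mul_nonneg {A : Matrix n n 𝕜} (hA : A.IsHermitian) :
    A.PosSemidef ↔ ∀ B : Matrix n n 𝕜, B.PosSemidef → 0 ≤ (A * B).trace :=
  ⟨fun h _ hB => NearestPositiveSemidefinite.trace_mul_nonneg h hB,
   posSemidef_of_forall_trace_mul_nonneg hA⟩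

/-- The same with the test matrix on the left: `A ⪰ 0 ↔ ∀ B ⪰ 0, 0 ≤ Tr(B A)`.
[cite: HornJohnson2012, Thm 7.5.4 p.485 (held chunk p0587)] -/
theorem posSemidef_iff_forall_trace_mul_nonneg' {A : Matrix n n 𝕜} (hA : A.IsHermitian) :
    A.PosSemidef ↔ ∀ B : Matrix n n 𝕜, B.PosSemidef → 0 ≤ (B * A).trace := by
  simp_rw [fun B : Matrix n n 𝕜 => trace_mul_comm B A]
  exact posSemidef_iff_forall_trace_mul_nonneg hA

/-- Set form of self-duality: the positive semidefinite matrices are exactly the Hermitian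
matrices pairing nonnegatively (under the trace form) with every positive semidefinite matrix —
the dual cone of `𝕊ⁿ₊` inside the Hermitian matrices is `𝕊ⁿ₊` itself.
[cite: BoydVandenberghe2004, Example 2.24 p.52 (held chunk p0048)] -/
theorem setOf_posSemidef_eq_dual :
    {A : Matrix n n 𝕜 | A.PosSemidef} =
      {A : Matrix n n 𝕜 | A.IsHermitian ∧ ∀ B : Matrix n n 𝕜, B.PosSemidef → 0 ≤ (A * B).trace} := by
  ext A
  exact ⟨fun h => ⟨h.isHermitian, (posSemidef_iff_forall_trace_mul_nonneg h.isHermitian).1 h⟩,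
    fun h => (posSemidef_iff_forall_trace_mul_nonneg h.1).2 h.2⟩

/-- Strict positivity against positive definite tests: if `A ⪰ 0`, `A ≠ 0` and `B ≻ 0` then
`Tr(A B) ≠ 0` (hence `0 < Tr(A B)` in the order of `𝕜`): `Tr(A B) = 0` would give `A B = 0`
and `B` is invertible. [cite: HornJohnson2012, Problem 7.6.P15 p.499 (held chunk p0601)] -/
theorem trace_mul_pos_of_posDef {A B : Matrix n n 𝕜} (hA : A.PosSemidef) (hA0 : A ≠ 0)
    (hB : B.PosDef) : 0 < (A * B).trace := by
  refine lt_of_le_of_ne (NearestPositiveSemidefinite.trace_mul_nonneg hA hB.posSemidef) fun h => hA0 ?_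
  have hAB : A * B = 0 :=
    (Computation.Certificates.SemidefiniteComplementarity.trace_mul_eq_zero_iff hA hB.posSemidef).1 h.symm
  have hBu : IsUnit B.det := (isUnit_iff_ne_zero.mpr hB.det_pos.ne')
  calc A = A * B * B⁻¹ := by rw [Matrix.mul_assoc, Matrix.mul_nonsing_inv _ hBu, Matrix.mul_one]
    _ = 0 := by rw [hAB, Matrix.zero_mul]

section Real

variable {m : Type*} [Fintype m] [DecidableEq m]

/-- Real form of Moutard–Fejér: a symmetric real matrix `A` is positive semidefinite iff
`0 ≤ Tr(A B)` for every positive semidefinite `B`.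
[cite: HornJohnson2012, Thm 7.5.4 p.485 (held chunk p0587)] -/
theorem real_posSemidef_iff_forall_trace_mul_nonneg {A : Matrix m m ℝ} (hA : A.IsSymm) :
    A.PosSemidef ↔ ∀ B : Matrix m m ℝ, B.PosSemidef → 0 ≤ (A * B).trace :=
  posSemidef_iff_forall_trace_mul_nonneg (𝕜 := ℝ) (show A.IsHermitian by
    unfold Matrix.IsHermitian; simpa using hA.eq)

omit [DecidableEq m] in
/-- Over `ℝ` the trace pairing only sees the symmetric part: `Tr(A B) = Tr(Aᵀ B)` for symmetric
`B`, hence `2 Tr(A B) = Tr((A + Aᵀ) B)` (why Boyd–Vandenberghe state self-duality on the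
symmetric matrices `𝐒ⁿ`). [cite: BoydVandenberghe2004, Example 2.24 p.52 (held chunk p0048)] -/
theorem two_mul_trace_mul_eq_trace_add_transpose_mul (A : Matrix m m ℝ) {B : Matrix m m ℝ}
    (hB : B.IsSymm) : 2 * (A * B).trace = ((A + Aᵀ) * B).trace := by
  have h : (Aᵀ * B).trace = (A * B).trace := by
    rw [← trace_transpose (A * B), transpose_mul, hB.eq, trace_mul_comm]
  rw [Matrix.add_mul, trace_add, h, two_mul]

/-- Without the symmetry hypothesis, nonnegative pairing with the PSD cone characterises
positive semidefiniteness of the SYMMETRIC PART: for a real square matrix `A`,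
`(∀ B ⪰ 0, 0 ≤ Tr(A B)) ↔ (A + Aᵀ) ⪰ 0`. [cite: HornJohnson2012, Thm 7.5.4 p.485 (held chunk p0587)] -/
theorem forall_trace_mul_nonneg_iff_posSemidef_add_transpose (A : Matrix m m ℝ) :
    (∀ B : Matrix m m ℝ, B.PosSemidef → 0 ≤ (A * B).trace) ↔ (A + Aᵀ).PosSemidef := by
  have hs : (A + Aᵀ).IsHermitian := by
    simp [Matrix.IsHermitian, add_comm]
  rw [posSemidef_iff_forall_trace_mul_nonneg (𝕜 := ℝ) hs]
  refine forall_congr' fun B => imp_congr_right fun hB => ?_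
  have hBs : B.IsSymm := by simpa [Matrix.IsSymm, Matrix.IsHermitian] using hB.isHermitian
  rw [← two_mul_trace_mul_eq_trace_add_transpose_mul A hBs]
  constructor
  · intro h; positivity
  · intro h; linarith

/-- The Hermitian hypothesis in Moutard–Fejér cannot be dropped: the real skew matrix
`!![0, 1; -1, 0]` pairs to `0` with every symmetric (in particular every PSD) matrix, yet it is
not positive semidefinite (it is not symmetric) — the reason the self-duality statement lives on
the symmetric matrices `𝐒ⁿ`. [cite: BoydVandenberghe2004, Example 2.24 p.52 (held chunk p0048)] -/
theorem skew_example_trace_mul_eq_zero (B : Matrix (Fin 2) (Fin 2) ℝ) (hB : B.IsSymm) :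
    (!![0, 1; -1, 0] * B).trace = 0 := by
  have h01 : B 0 1 = B 1 0 := by simpa using congr_fun (congr_fun hB.eq 1) 0
  rw [Matrix.trace_fin_two]
  simp [Matrix.mul_apply, Fin.sum_univ_two]
  linarith

/-- … and `!![0, 1; -1, 0]` is not positive semidefinite (not symmetric). [cite: BoydVandenberghe2004, Example 2.24 p.52 (held chunk p0048)] -/
theorem skew_example_not_posSemidef : ¬ (!![0, 1; -1, 0] : Matrix (Fin 2) (Fin 2) ℝ).PosSemidef := by
  intro h
  have := congr_fun (congr_fun h.isHermitian.eq 0) 1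
  simp [conjTranspose_apply] at this
  linarith

end Real

end Literature.LinearAlgebra.Matrix.PsdConeSelfDual
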